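import Mathlib
import HarnessLib
import Literature.Analysis.FluidPDE.TaoCascadeNoLow
import Literature.Analysis.FluidPDE.Tao2016AveragedNS.WeightedLatticeFlows
import Literature.Analysis.FluidPDE.Tao2016AveragedNS.RenormalisedCascadeWaves

/-!
# Route `WakeRatchet`, crux `MinimalViscousBlowup` (stmt-NavierStokesRegularity-22743) — LINE g11-1 «threshold ray» (ns-idea-1 g11), inputs (H), (F1), (F2)
# of STUB-PLAN-everyShellFires.md for stub S4 `stub_everyShellFires`: THE CLOSED VALVE

`λ = 1+ε₀ > 1`, a cancelling table ((4.3)), the `ν`-viscous NS-scaled cascade lattice within a time window.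
* `hasDerivWithinAt_blockEnergy` — (H, finite form) the energy of the block of shells `[K, L)` has derivative
  `Π_{K−1} − Π_{L−1} − ν Σ_{K≤k<L} λ^{2k}‖X_k‖²` (`Π_k = botSum`, the bond flux through `(k, k+1)`);
* `abs_botSum_le_norm_shellVec` — (F1) `|Π_n| ≤ m³ λ^{5n/2} ‖X_n‖² ‖X_{n+1}‖` when `|α_{··(0,0,1)}| ≤ 1`;
* `abs_botSum_le_of_weight10` — the top flux is geometrically small under a (4.5) bound, `|Π_n| ≤ m³M³λ^{−(n+1)}`;
* `closedValve_step` — **(F2) CLOSED VALVE ⇒ TRAPPED TAIL**: if shell `n ≥ 0` obeys `λ^n‖X_n(t)‖² ≤ cν²` on `[0,T']` (block above `n` empty at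
  `t = 0`, (4.5) bound on `[0,T']`), then `λ^{n+1}‖X_{n+1}(t)‖² ≤ 4m⁶c²ν²λ^{−3}` on `[0,T']`: the block energy `y = E_{(n,L)}` obeys
  `y' ≤ a√(2y) + ε_L − 2by` (`a = m³cν²λ^{3n/2}`, `b = νλ^{2n+2}`, `ε_L → 0`), and the constant fence `4y⋆ = 2a²/b²` is never crossed
  (`image_le_of_deriv_right_lt_deriv_boundary`).
MODEL lattice ODEs only; nothing here concerns the Navier–Stokes equations.  `--supports stmt-NavierStokesRegularity-22743 --as helper`.
[cite: Tao2016AveragedNS, §4 (4.3), Lemma 4.1 (4.5), proof of (4.13) (energy identity); BarbatoMorandinRomito2011, §3.1 (invariant regions for the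
viscous dyadic model)]
-/

noncomputable section

-- the summit and its single sub-problem share the name (CONVENTIONS §1)
set_option linter.dupNamespace false

open Set Filter Topology

namespace Summit.NavierStokesRegularity.NavierStokesRegularity.Theorems.MinimalViscousBlowup.ThresholdRay

open Literature.Analysis.FluidPDE Literature.Analysis.FluidPDE.TaoCascade

variable {m : ℕ}

/-! ### §0 The Euclidean shell vector -/

/-- `‖X_k(t)‖² = Σ_i X_{i,k}(t)²`. [folklore] -/
theorem norm_shellVec_sq (X : Fin m → ℤ → ℝ → ℝ) (k : ℤ) (t : ℝ) :
    ‖shellVec X k t‖ ^ 2 = ∑ i : Fin m, X i k t ^ 2 := by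
  rw [EuclideanSpace.norm_sq_eq]
  exact Finset.sum_congr rfl fun i _ => by rw [shellVec_apply, Real.norm_eq_abs, sq_abs]

/-- `|X_{j,k}(t)| ≤ ‖X_k(t)‖`. [folklore] -/
theorem abs_apply_le_norm_shellVec (X : Fin m → ℤ → ℝ → ℝ) (k : ℤ) (t : ℝ) (j : Fin m) :
    |X j k t| ≤ ‖shellVec X k t‖ := by
  -- adapted from ns-idea-1's line kit `bond_flux.lean`
  simpa [Real.norm_eq_abs, shellVec_apply] using PiLp.norm_apply_le (shellVec X k t) j

/-! ### §1 (H, finite form) The block energy identity -/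

/-- **Block energy identity.**  For a cancelling table and a family solving the `ν`-viscous lattice within `s` at `u`,
`d/dt Σ_{K≤k<L} Σ_i ½X_{i,k}² = Π_{K−1} − Π_{L−1} − ν Σ_{K≤k<L} λ^{2k} Σ_i X_{i,k}²` at `u` within `s`. [cite: Tao2016AveragedNS, §4 proof of (4.13)] -/
theorem hasDerivWithinAt_blockEnergy {ε₀ ν : ℝ} {α : Fin m → Fin m → Fin m → ℤ × ℤ × ℤ → ℝ} (hc : IsCancellingCoeff α)
    {X : Fin m → ℤ → ℝ → ℝ} {s : Set ℝ} {u : ℝ}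
    (hder : ∀ (i : Fin m) (k : ℤ), HasDerivWithinAt (X i k)
      (quadTerm ε₀ α X i k u - ν * (1 + ε₀) ^ ((2 : ℝ) * k) * X i k u) s u)
    {K L : ℕ} (hKL : K ≤ L) :
    HasDerivWithinAt (fun w => ∑ k ∈ Finset.Ico K L, ∑ i : Fin m, (1 / 2 : ℝ) * X i k w ^ 2)
      (botSum ε₀ α X ((K : ℤ) - 1) u - botSum ε₀ α X ((L : ℤ) - 1) u -
        ν * ∑ k ∈ Finset.Ico K L, (1 + ε₀) ^ ((2 : ℝ) * (k : ℤ)) * ∑ i : Fin m, X i k u ^ 2) s u := by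
  -- adapted from `hasDerivWithinAt_truncEnergy` (Theorems/WakeRatchetMinimalViscousBlowupEnergyBudget.lean)
  have hshell : ∀ k : ℤ, HasDerivWithinAt (fun w => ∑ i : Fin m, (1 / 2 : ℝ) * X i k w ^ 2)
      (botSum ε₀ α X (k - 1) u - botSum ε₀ α X k u - ν * (1 + ε₀) ^ ((2 : ℝ) * k) * ∑ i : Fin m, X i k u ^ 2) s u := by
    intro k
    have h := HasDerivWithinAt.fun_sum (u := Finset.univ)
      fun (i : Fin m) (_ : i ∈ Finset.univ) => ((hder i k).pow 2).const_mul (1 / 2 : ℝ)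
    refine h.congr_deriv ?_
    have hsq := sum_quadTerm_mul ε₀ α X k u
    rw [botSum_eq_neg_topSum ε₀ hc X k u]
    calc ∑ i : Fin m, (1 / 2 : ℝ) * (((2 : ℕ) : ℝ) * X i k u ^ (2 - 1) *
            (quadTerm ε₀ α X i k u - ν * (1 + ε₀) ^ ((2 : ℝ) * k) * X i k u))
        = (∑ i : Fin m, quadTerm ε₀ α X i k u * X i k u) -
            ν * (1 + ε₀) ^ ((2 : ℝ) * k) * ∑ i : Fin m, X i k u ^ 2 := by
          rw [Finset.mul_sum, ← Finset.sum_sub_distrib]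
          refine Finset.sum_congr rfl fun i _ => ?_
          push_cast
          ring
      _ = _ := by rw [hsq]; ring
  have htel : ∑ k ∈ Finset.Ico K L, (botSum ε₀ α X ((k : ℤ) - 1) u - botSum ε₀ α X k u) =
      botSum ε₀ α X ((K : ℤ) - 1) u - botSum ε₀ α X ((L : ℤ) - 1) u := by
    induction L, hKL using Nat.le_induction with
    | base => simp
    | succ L hKL ih =>
      rw [Finset.sum_Ico_succ_top hKL, ih]
      push_cast
      ring
  have hsum := HasDerivWithinAt.fun_sum (u := Finset.Ico K L) fun (k : ℕ) (_ : k ∈ Finset.Ico K L) => hshell k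
  refine hsum.congr_deriv ?_
  rw [Finset.sum_sub_distrib, htel, Finset.mul_sum]
  exact congrArg₂ _ rfl (Finset.sum_congr rfl fun k _ => by ring)

/-! ### §2 (F1) The bond flux in the shell-vector currency, and its decay under a (4.5) bound -/

/-- **(F1) Bond-flux bound**: `|Π_n| ≤ m³ · λ^{5n/2} · ‖X_n‖² · ‖X_{n+1}‖` when `|α_{i₁i₂i₃,(0,0,1)}| ≤ 1` (`m³` monomials, `|X^j_k| ≤ ‖X_k‖`).
[cite: Tao2016AveragedNS, §4 (4.1)–(4.2)] -/
theorem abs_botSum_le_norm_shellVec {ε₀ : ℝ} (hl0 : 0 < 1 + ε₀) {α : Fin m → Fin m → Fin m → ℤ × ℤ × ℤ → ℝ}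
    (hα1 : ∀ i₁ i₂ i₃, |α i₁ i₂ i₃ (0, 0, 1)| ≤ 1) (X : Fin m → ℤ → ℝ → ℝ) (n : ℤ) (t : ℝ) :
    |botSum ε₀ α X n t| ≤
      (m : ℝ) ^ 3 * (1 + ε₀) ^ ((5 : ℝ) * n / 2) * ‖shellVec X n t‖ ^ 2 * ‖shellVec X (n + 1) t‖ := by
  -- adapted from ns-idea-1's line kit `bond_flux.lean` (`abs_botSum_le_norm`, m = 4)
  have hΛ : 0 < (1 + ε₀) ^ ((5 : ℝ) * n / 2) := Real.rpow_pos_of_pos hl0 _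
  set s := (1 + ε₀) ^ ((5 : ℝ) * n / 2) with hs
  set a := ‖shellVec X n t‖ with ha
  set b := ‖shellVec X (n + 1) t‖ with hb
  have ha0 : 0 ≤ a := norm_nonneg _
  have hb0 : 0 ≤ b := norm_nonneg _
  have hterm : ∀ i₁ i₂ i₃ : Fin m,
      |α i₁ i₂ i₃ (0, 0, 1) * s * (X i₁ n t * X i₂ n t * X i₃ (n + 1) t)| ≤ s * (a * a * b) := by
    intro i₁ i₂ i₃
    have h1 := hα1 i₁ i₂ i₃
    have h2 : |X i₁ n t| ≤ a := abs_apply_le_norm_shellVec X n t i₁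
    have h3 : |X i₂ n t| ≤ a := abs_apply_le_norm_shellVec X n t i₂
    have h4 : |X i₃ (n + 1) t| ≤ b := abs_apply_le_norm_shellVec X (n + 1) t i₃
    rw [abs_mul, abs_mul, abs_mul, abs_mul, abs_of_pos hΛ]
    calc |α i₁ i₂ i₃ (0, 0, 1)| * s * (|X i₁ n t| * |X i₂ n t| * |X i₃ (n + 1) t|)
        ≤ 1 * s * (a * a * b) := by gcongr
      _ = s * (a * a * b) := by ring
  unfold botSum
  calc |∑ i₁ : Fin m, ∑ i₂ : Fin m, ∑ i₃ : Fin m,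
          α i₁ i₂ i₃ (0, 0, 1) * s * (X i₁ n t * X i₂ n t * X i₃ (n + 1) t)|
      ≤ ∑ i₁ : Fin m, |∑ i₂ : Fin m, ∑ i₃ : Fin m,
          α i₁ i₂ i₃ (0, 0, 1) * s * (X i₁ n t * X i₂ n t * X i₃ (n + 1) t)| :=
        Finset.abs_sum_le_sum_abs _ _
    _ ≤ ∑ i₁ : Fin m, ∑ i₂ : Fin m, |∑ i₃ : Fin m,
          α i₁ i₂ i₃ (0, 0, 1) * s * (X i₁ n t * X i₂ n t * X i₃ (n + 1) t)| :=
        Finset.sum_le_sum fun i₁ _ => Finset.abs_sum_le_sum_abs _ _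
    _ ≤ ∑ i₁ : Fin m, ∑ i₂ : Fin m, ∑ i₃ : Fin m,
          |α i₁ i₂ i₃ (0, 0, 1) * s * (X i₁ n t * X i₂ n t * X i₃ (n + 1) t)| :=
        Finset.sum_le_sum fun i₁ _ => Finset.sum_le_sum fun i₂ _ => Finset.abs_sum_le_sum_abs _ _
    _ ≤ ∑ _i₁ : Fin m, ∑ _i₂ : Fin m, ∑ _i₃ : Fin m, s * (a * a * b) :=
        Finset.sum_le_sum fun i₁ _ => Finset.sum_le_sum fun i₂ _ => Finset.sum_le_sum fun i₃ _ => hterm i₁ i₂ i₃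
    _ = (m : ℝ) ^ 3 * s * a ^ 2 * b := by
        simp [Finset.sum_const, Finset.card_univ, Fintype.card_fin]; ring

/-- **The flux out of a regular block is geometrically small**: under the (4.5)-weighted bound `(1+λ^{10k})|X_{i,k}(t)| ≤ M` (all `i, k`) and
`|α_{··(0,0,1)}| ≤ 1`, `|Π_n(t)| ≤ m³ M³ λ^{−(n+1)}` for every `n ≥ 0`. [cite: Tao2016AveragedNS, §4 Lemma 4.1 (4.5)] -/
theorem abs_botSum_le_of_weight10 {ε₀ M : ℝ} (hε : 0 < ε₀) (hM0 : 0 ≤ M) {α : Fin m → Fin m → Fin m → ℤ × ℤ × ℤ → ℝ}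
    (hα1 : ∀ i₁ i₂ i₃, |α i₁ i₂ i₃ (0, 0, 1)| ≤ 1) {X : Fin m → ℤ → ℝ → ℝ} {t : ℝ}
    (hM : ∀ (i : Fin m) (k : ℤ), (1 + (1 + ε₀) ^ ((10 : ℝ) * k)) * |X i k t| ≤ M) (n : ℕ) :
    |botSum ε₀ α X n t| ≤ (m : ℝ) ^ 3 * M ^ 3 * ((1 + ε₀)⁻¹) ^ (n + 1) := by
  -- adapted from the proof of `exists_small_dissipation_time` (Theorems/WakeRatchetMinimalViscousBlowupEnergyBudget.lean)
  have hl0 : (0 : ℝ) < 1 + ε₀ := by linarith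
  have hl1 : (1 : ℝ) < 1 + ε₀ := by linarith
  set r : ℝ := (1 + ε₀)⁻¹ with hr
  have hr0 : 0 < r := inv_pos.2 hl0
  have hsplit : ∀ a b : ℝ, (1 + ε₀) ^ a = (1 + ε₀) ^ (a - b) * (1 + ε₀) ^ b := fun a b => by
    rw [← Real.rpow_add hl0]; ring_nf
  have hmono : ∀ a b : ℝ, a ≤ b → (1 + ε₀) ^ a ≤ (1 + ε₀) ^ b := fun a b h =>
    Real.rpow_le_rpow_of_exponent_le hl1.le h
  have hrnat : ∀ j : ℕ, (1 + ε₀) ^ (-(j : ℝ)) = r ^ j := fun j => by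
    rw [Real.rpow_neg hl0.le, Real.rpow_natCast, inv_pow]
  have hXle : ∀ (i : Fin m) (k : ℤ), |X i k t| ≤ M := by
    intro i k
    have h := hM i k
    have hp : 0 < (1 + ε₀) ^ ((10 : ℝ) * k) := Real.rpow_pos_of_pos hl0 _
    nlinarith [abs_nonneg (X i k t)]
  have hXdec : ∀ (i : Fin m) (k : ℤ), (1 + ε₀) ^ ((10 : ℝ) * k) * |X i k t| ≤ M := by
    intro i k
    have h := hM i k
    nlinarith [abs_nonneg (X i k t)]
  have hkey : ∀ i₃ : Fin m,
      (1 + ε₀) ^ ((5 : ℝ) * ((n : ℕ) : ℤ) / 2) * |X i₃ (((n : ℕ) : ℤ) + 1) t| ≤ M * r ^ (n + 1) := by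
    intro i₃
    have h1 := hXdec i₃ (((n : ℕ) : ℤ) + 1)
    have h4 : (1 + ε₀) ^ ((5 : ℝ) * ((n : ℕ) : ℤ) / 2 - (10 : ℝ) * ((((n : ℕ) : ℤ) + 1 : ℤ) : ℝ)) ≤ r ^ (n + 1) := by
      rw [← hrnat (n + 1)]
      exact hmono _ _ (by push_cast; nlinarith [(Nat.cast_nonneg n : (0 : ℝ) ≤ n)])
    calc (1 + ε₀) ^ ((5 : ℝ) * ((n : ℕ) : ℤ) / 2) * |X i₃ (((n : ℕ) : ℤ) + 1) t|
        = (1 + ε₀) ^ ((5 : ℝ) * ((n : ℕ) : ℤ) / 2 - (10 : ℝ) * ((((n : ℕ) : ℤ) + 1 : ℤ) : ℝ)) *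
            ((1 + ε₀) ^ ((10 : ℝ) * ((((n : ℕ) : ℤ) + 1 : ℤ) : ℝ)) * |X i₃ (((n : ℕ) : ℤ) + 1) t|) := by
          rw [hsplit ((5 : ℝ) * ((n : ℕ) : ℤ) / 2) ((10 : ℝ) * ((((n : ℕ) : ℤ) + 1 : ℤ) : ℝ))]; ring
      _ ≤ r ^ (n + 1) * M :=
          mul_le_mul h4 h1 (mul_nonneg (Real.rpow_nonneg hl0.le _) (abs_nonneg _)) (pow_nonneg hr0.le _)
      _ = M * r ^ (n + 1) := mul_comm _ _
  have hterm : ∀ i₁ i₂ i₃ : Fin m,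
      |α i₁ i₂ i₃ (0, 0, 1) * (1 + ε₀) ^ ((5 : ℝ) * ((n : ℕ) : ℤ) / 2) *
          (X i₁ n t * X i₂ n t * X i₃ (((n : ℕ) : ℤ) + 1) t)| ≤ M * M * (M * r ^ (n + 1)) := by
    intro i₁ i₂ i₃
    rw [abs_mul, abs_mul, abs_mul, abs_mul, abs_of_pos (Real.rpow_pos_of_pos hl0 _)]
    have hXX : |X i₁ n t| * |X i₂ n t| ≤ M * M :=
      mul_le_mul (hXle i₁ n) (hXle i₂ n) (abs_nonneg _) hM0
    calc |α i₁ i₂ i₃ (0, 0, 1)| * (1 + ε₀) ^ ((5 : ℝ) * ((n : ℕ) : ℤ) / 2) *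
          (|X i₁ n t| * |X i₂ n t| * |X i₃ (((n : ℕ) : ℤ) + 1) t|)
        = |α i₁ i₂ i₃ (0, 0, 1)| * (|X i₁ n t| * |X i₂ n t|) *
            ((1 + ε₀) ^ ((5 : ℝ) * ((n : ℕ) : ℤ) / 2) * |X i₃ (((n : ℕ) : ℤ) + 1) t|) := by ring
      _ ≤ 1 * (M * M) * (M * r ^ (n + 1)) :=
          mul_le_mul (mul_le_mul (hα1 i₁ i₂ i₃) hXX (by positivity) zero_le_one) (hkey i₃)
            (by positivity) (mul_nonneg zero_le_one (mul_nonneg hM0 hM0))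
      _ = M * M * (M * r ^ (n + 1)) := by ring
  unfold botSum
  calc |∑ i₁ : Fin m, ∑ i₂ : Fin m, ∑ i₃ : Fin m, α i₁ i₂ i₃ (0, 0, 1) * (1 + ε₀) ^ ((5 : ℝ) * ((n : ℕ) : ℤ) / 2) *
          (X i₁ n t * X i₂ n t * X i₃ (((n : ℕ) : ℤ) + 1) t)|
      ≤ ∑ i₁ : Fin m, ∑ i₂ : Fin m, ∑ i₃ : Fin m, |α i₁ i₂ i₃ (0, 0, 1) * (1 + ε₀) ^ ((5 : ℝ) * ((n : ℕ) : ℤ) / 2) *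
          (X i₁ n t * X i₂ n t * X i₃ (((n : ℕ) : ℤ) + 1) t)| := by
        refine (Finset.abs_sum_le_sum_abs _ _).trans (Finset.sum_le_sum fun i₁ _ => ?_)
        exact (Finset.abs_sum_le_sum_abs _ _).trans (Finset.sum_le_sum fun i₂ _ => Finset.abs_sum_le_sum_abs _ _)
    _ ≤ ∑ _i₁ : Fin m, ∑ _i₂ : Fin m, ∑ _i₃ : Fin m, M * M * (M * r ^ (n + 1)) :=
        Finset.sum_le_sum fun i₁ _ => Finset.sum_le_sum fun i₂ _ => Finset.sum_le_sum fun i₃ _ => hterm i₁ i₂ i₃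
    _ = (m : ℝ) ^ 3 * M ^ 3 * r ^ (n + 1) := by
        simp [Finset.sum_const, Finset.card_univ, Fintype.card_fin]; ring

/-! ### §3 (F2) Closed valve ⇒ trapped tail -/

/-- **(F2) CLOSED VALVE ⇒ TRAPPED TAIL.**  `λ = 1+ε₀ > 1`, `ν > 0`, cancelling table with `|α_{··(0,0,1)}| ≤ 1`; a solution of the `ν`-viscous
lattice within `[0,T']` whose shells above `n` vanish at `t = 0` and which obeys a (4.5) bound on `[0,T']`.  If the shell `n ≥ 0` is a CLOSED
VALVE, `λ^n‖X_n(t)‖² ≤ cν²` on `[0,T']` (`c > 0`), then the next shell is trapped: `λ^{n+1}‖X_{n+1}(t)‖² ≤ 4m⁶c²ν²λ^{−3}` on `[0,T']`.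
[cite: BarbatoMorandinRomito2011, §3.1 (invariant regions for the viscous dyadic model); Tao2016AveragedNS, §4 proof of (4.13)] -/
theorem closedValve_step {ε₀ ν M c T' : ℝ} (hε : 0 < ε₀) (hν : 0 < ν) (hM0 : 0 ≤ M) (hc0 : 0 < c)
    {α : Fin m → Fin m → Fin m → ℤ × ℤ × ℤ → ℝ} (hcan : IsCancellingCoeff α) (hα1 : ∀ i₁ i₂ i₃, |α i₁ i₂ i₃ (0, 0, 1)| ≤ 1)
    {X : Fin m → ℤ → ℝ → ℝ}
    (hder : ∀ (i : Fin m) (k : ℤ), ∀ t ∈ Icc 0 T', HasDerivWithinAt (X i k)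
      (quadTerm ε₀ α X i k t - ν * (1 + ε₀) ^ ((2 : ℝ) * k) * X i k t) (Icc 0 T') t)
    (hM : ∀ t ∈ Icc 0 T', ∀ (i : Fin m) (k : ℤ), (1 + (1 + ε₀) ^ ((10 : ℝ) * k)) * |X i k t| ≤ M)
    (n : ℕ) (hinit : ∀ (i : Fin m) (k : ℕ), n < k → X i k 0 = 0)
    (hvalve : ∀ t ∈ Icc 0 T', (1 + ε₀) ^ n * ‖shellVec X n t‖ ^ 2 ≤ c * ν ^ 2) :
    ∀ t ∈ Icc 0 T', (1 + ε₀) ^ (n + 1) * ‖shellVec X ((n : ℤ) + 1) t‖ ^ 2 ≤ 4 * (m : ℝ) ^ 6 * c ^ 2 * ν ^ 2 / (1 + ε₀) ^ 3 := by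
  intro t₀ ht₀
  have hl0 : (0 : ℝ) < 1 + ε₀ := by linarith
  have hl1 : (1 : ℝ) < 1 + ε₀ := by linarith
  have hpow : ∀ a : ℝ, 0 < (1 + ε₀) ^ a := fun a => Real.rpow_pos_of_pos hl0 a
  -- the empty lattice
  rcases Nat.eq_zero_or_pos m with hm | hm
  · subst hm
    rw [norm_shellVec_sq]
    simp only [Finset.univ_eq_empty, Finset.sum_empty, mul_zero]
    positivity
  have hm0 : (0 : ℝ) < m := by exact_mod_cast hm
  -- the powers of `λ` in play
  set P5 : ℝ := (1 + ε₀) ^ ((5 : ℝ) * ((n : ℕ) : ℤ) / 2) with hP5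
  have hP50 : 0 < P5 := hpow _
  have hP5sq : P5 ^ 2 = (1 + ε₀) ^ (5 * n) := by
    have he : (5 : ℝ) * (((n : ℕ) : ℤ) : ℝ) / 2 * ((2 : ℕ) : ℝ) = ((5 * n : ℕ) : ℝ) := by push_cast; ring
    rw [hP5, ← Real.rpow_natCast _ 2, ← Real.rpow_mul hl0.le, he, Real.rpow_natCast]
  set P2 : ℝ := (1 + ε₀) ^ ((2 : ℝ) * ((((n + 1 : ℕ)) : ℤ) : ℝ)) with hP2
  have hP2eq : P2 = (1 + ε₀) ^ (2 * n + 2) := by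
    have he : (2 : ℝ) * ((((n + 1 : ℕ)) : ℤ) : ℝ) = ((2 * n + 2 : ℕ) : ℝ) := by push_cast; ring
    rw [hP2, he, Real.rpow_natCast]
  have hP20 : 0 < P2 := hpow _
  have hLn : (0 : ℝ) < (1 + ε₀) ^ n := pow_pos hl0 n
  -- the valve constant `a > 0` and the dissipation floor `b > 0`
  set a : ℝ := (m : ℝ) ^ 3 * c * ν ^ 2 * P5 / (1 + ε₀) ^ n with ha
  set b : ℝ := ν * P2 with hb
  have hb0 : 0 < b := mul_pos hν hP20
  have ha0 : 0 < a := by rw [ha]; positivity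
  -- the fence `Y = 4y⋆ = 2a²/b²`
  set Y : ℝ := 2 * a ^ 2 / b ^ 2 with hY
  have hY0 : 0 ≤ Y := by rw [hY]; positivity
  have hsqY : Real.sqrt (2 * Y) = 2 * a / b := by
    rw [hY, show 2 * (2 * a ^ 2 / b ^ 2) = (2 * a / b) ^ 2 by rw [div_pow]; ring]
    exact Real.sqrt_sq (by positivity)
  -- the flux through the valve
  have hvalveflux : ∀ t ∈ Icc 0 T', |botSum ε₀ α X n t| ≤ a * ‖shellVec X ((n : ℤ) + 1) t‖ := by
    intro t ht
    refine (abs_botSum_le_norm_shellVec hl0 hα1 X n t).trans ?_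
    have hv := hvalve t ht
    have h1 : ‖shellVec X (n : ℤ) t‖ ^ 2 ≤ c * ν ^ 2 / (1 + ε₀) ^ n := by
      rw [le_div_iff₀ hLn]; linarith
    have h2 := mul_le_mul_of_nonneg_left h1
      (by positivity : (0 : ℝ) ≤ (m : ℝ) ^ 3 * P5 * ‖shellVec X ((n : ℤ) + 1) t‖)
    calc (m : ℝ) ^ 3 * P5 * ‖shellVec X (n : ℤ) t‖ ^ 2 * ‖shellVec X ((n : ℤ) + 1) t‖
        = (m : ℝ) ^ 3 * P5 * ‖shellVec X ((n : ℤ) + 1) t‖ * ‖shellVec X (n : ℤ) t‖ ^ 2 := by ring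
      _ ≤ (m : ℝ) ^ 3 * P5 * ‖shellVec X ((n : ℤ) + 1) t‖ * (c * ν ^ 2 / (1 + ε₀) ^ n) := h2
      _ = a * ‖shellVec X ((n : ℤ) + 1) t‖ := by rw [ha]; ring
  -- the flux out of the top of a block `[n+1, L)` is geometrically small
  set r : ℝ := (1 + ε₀)⁻¹ with hr
  have hr0 : 0 < r := inv_pos.2 hl0
  have hr1 : r < 1 := inv_lt_one_of_one_lt₀ hl1
  have htop : ∀ L' : ℕ, ∀ t ∈ Icc 0 T', |botSum ε₀ α X (((L' + 1 : ℕ) : ℤ) - 1) t| ≤ (m : ℝ) ^ 3 * M ^ 3 * r ^ (L' + 1) := by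
    intro L' t ht
    have h := abs_botSum_le_of_weight10 (m := m) hε hM0 hα1 (hM t ht) L'
    have hcast : (((L' + 1 : ℕ) : ℤ) - 1 : ℤ) = ((L' : ℕ) : ℤ) := by push_cast; ring
    rw [hcast]
    exact h
  -- choice of the block top: `L = L' + 1` with `L' ≥ n + 1` and `m³M³ r^L ≤ a²/b`
  have hΦ0 : 0 ≤ (m : ℝ) ^ 3 * M ^ 3 := by positivity
  obtain ⟨L₁, hL₁⟩ := exists_pow_lt_of_lt_one (show 0 < a ^ 2 / b / ((m : ℝ) ^ 3 * M ^ 3 + 1) by positivity) hr1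
  set L' : ℕ := L₁ + n + 1 with hL'
  set L : ℕ := L' + 1 with hL
  have hnL : n + 1 ≤ L := by omega
  have hnL' : n + 1 < L := by omega
  have hrL : r ^ (L' + 1) ≤ r ^ L₁ := pow_le_pow_of_le_one hr0.le hr1.le (by omega)
  have hεL : ∀ t ∈ Icc 0 T', |botSum ε₀ α X (((L' + 1 : ℕ) : ℤ) - 1) t| ≤ a ^ 2 / b := by
    intro t ht
    refine (htop L' t ht).trans ?_
    have h1 : (m : ℝ) ^ 3 * M ^ 3 * r ^ (L' + 1) ≤ ((m : ℝ) ^ 3 * M ^ 3 + 1) * r ^ L₁ := by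
      have := pow_nonneg hr0.le (L' + 1)
      nlinarith [hrL]
    have h2 : ((m : ℝ) ^ 3 * M ^ 3 + 1) * r ^ L₁ ≤ a ^ 2 / b := by
      have := (lt_div_iff₀ (by positivity : (0 : ℝ) < (m : ℝ) ^ 3 * M ^ 3 + 1)).1 hL₁
      linarith
    exact h1.trans h2
  -- the block energy `f = E_{[n+1, L)}` and its derivative
  set f : ℝ → ℝ := fun w => ∑ k ∈ Finset.Ico (n + 1) L, ∑ i : Fin m, (1 / 2 : ℝ) * X i k w ^ 2 with hf
  set f' : ℝ → ℝ := fun w => botSum ε₀ α X (((n + 1 : ℕ) : ℤ) - 1) w - botSum ε₀ α X ((L : ℤ) - 1) w -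
    ν * ∑ k ∈ Finset.Ico (n + 1) L, (1 + ε₀) ^ ((2 : ℝ) * (k : ℤ)) * ∑ i : Fin m, X i k w ^ 2 with hf'
  have hXc : ∀ (i : Fin m) (k : ℤ), ContinuousOn (X i k) (Icc 0 T') := fun i k u hu => (hder i k u hu).continuousWithinAt
  have hfc : ContinuousOn f (Icc 0 T') :=
    continuousOn_finsetSum _ fun k _ => continuousOn_finsetSum _ fun i _ => continuousOn_const.mul ((hXc i k).pow 2)
  have hfd : ∀ x ∈ Ico (0 : ℝ) T', HasDerivWithinAt f (f' x) (Ici x) x := by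
    intro x hx
    have h := hasDerivWithinAt_blockEnergy (ε₀ := ε₀) (ν := ν) hcan (fun i k => hder i k x (Ico_subset_Icc_self hx)) hnL
    exact h.mono_of_mem_nhdsWithin (mem_of_superset (Icc_mem_nhdsGE hx.2) (Icc_subset_Icc hx.1 le_rfl))
  have hf0 : f 0 ≤ Y := by
    have : f 0 = 0 := by
      refine Finset.sum_eq_zero fun k hk => Finset.sum_eq_zero fun i _ => ?_
      rw [hinit i k (by simp only [Finset.mem_Ico] at hk; omega)]
      ring
    rw [this]; exact hY0
  -- shell `n+1` sits in the block: `‖X_{n+1}‖² ≤ 2 f`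
  have hshell_le : ∀ w, ‖shellVec X ((n : ℤ) + 1) w‖ ^ 2 ≤ 2 * f w := by
    intro w
    have hmem : n + 1 ∈ Finset.Ico (n + 1) L := Finset.mem_Ico.2 ⟨le_rfl, hnL'⟩
    have h1 : (∑ i : Fin m, (1 / 2 : ℝ) * X i ((n + 1 : ℕ) : ℤ) w ^ 2) ≤ f w :=
      Finset.single_le_sum (s := Finset.Ico (n + 1) L) (f := fun k : ℕ => ∑ i : Fin m, (1 / 2 : ℝ) * X i (k : ℤ) w ^ 2)
        (fun k _ => Finset.sum_nonneg fun i _ => by positivity) hmem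
    have h2 : ∑ i : Fin m, (1 / 2 : ℝ) * X i ((n + 1 : ℕ) : ℤ) w ^ 2 = (1 / 2) * ‖shellVec X ((n : ℤ) + 1) w‖ ^ 2 := by
      rw [norm_shellVec_sq, Finset.mul_sum]; push_cast; rfl
    simp only [hf] at h1 ⊢
    linarith [h1, h2.symm.le, h2.le]
  -- the dissipation floor: `Σ_{k ≥ n+1} λ^{2k} Σ_i X² ≥ P2 · 2f`
  have hdiss : ∀ w, P2 * (2 * f w) ≤ ∑ k ∈ Finset.Ico (n + 1) L, (1 + ε₀) ^ ((2 : ℝ) * (k : ℤ)) * ∑ i : Fin m, X i k w ^ 2 := by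
    intro w
    have h2f : 2 * f w = ∑ k ∈ Finset.Ico (n + 1) L, ∑ i : Fin m, X i k w ^ 2 := by
      simp only [hf, Finset.mul_sum]
      exact Finset.sum_congr rfl fun k _ => Finset.sum_congr rfl fun i _ => by ring
    rw [h2f, Finset.mul_sum]
    refine Finset.sum_le_sum fun k hk => mul_le_mul_of_nonneg_right ?_ (Finset.sum_nonneg fun i _ => sq_nonneg _)
    rw [hP2]
    refine Real.rpow_le_rpow_of_exponent_le hl1.le ?_
    have hk' : n + 1 ≤ k := (Finset.mem_Ico.1 hk).1
    have : ((n + 1 : ℕ) : ℝ) ≤ (k : ℝ) := by exact_mod_cast hk'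
    push_cast at this ⊢
    linarith
  -- the fence is never touched from below with nonnegative slope
  have hbound : ∀ x ∈ Ico (0 : ℝ) T', f x = Y → f' x < 0 := by
    intro x hx hfx
    have hxT : x ∈ Icc 0 T' := Ico_subset_Icc_self hx
    have hnorm : ‖shellVec X ((n : ℤ) + 1) x‖ ≤ 2 * a / b := by
      rw [← hsqY]
      refine (Real.le_sqrt (norm_nonneg _) (mul_nonneg zero_le_two hY0)).2 ?_
      rw [← hfx]; exact hshell_le x
    have h1 : |botSum ε₀ α X n x| ≤ a * (2 * a / b) :=
      (hvalveflux x hxT).trans (mul_le_mul_of_nonneg_left hnorm ha0.le)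
    have h2 := hεL x hxT
    have h3 := hdiss x
    rw [hfx] at h3
    have hcast : (((n + 1 : ℕ) : ℤ) - 1 : ℤ) = (n : ℤ) := by push_cast; ring
    have hLc : ((L : ℤ) - 1 : ℤ) = (((L' + 1 : ℕ) : ℤ) - 1 : ℤ) := by rw [hL]
    have e1 := (abs_le.1 h1).2
    have e2 := (abs_le.1 h2).1
    simp only [hf']
    rw [hcast, hLc]
    have hab : a * (2 * a / b) = 2 * (a ^ 2 / b) := by ring
    have hbY : ν * (P2 * (2 * Y)) = 4 * (a ^ 2 / b) := by
      rw [hY, hb]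
      have hν0 : ν ≠ 0 := hν.ne'
      have hP : P2 ≠ 0 := hP20.ne'
      field_simp
      norm_num
    have hpos : 0 < a ^ 2 / b := by positivity
    nlinarith [e1, e2, h3, hab, hbY, hpos, hν]
  have hfence := image_le_of_deriv_right_lt_deriv_boundary hfc hfd hf0 (fun x => hasDerivAt_const x Y) hbound ht₀
  -- conclusion at `t₀`
  have hfin : ‖shellVec X ((n : ℤ) + 1) t₀‖ ^ 2 ≤ 2 * Y := (hshell_le t₀).trans (by linarith)
  have hval : (1 + ε₀) ^ (n + 1) * (2 * Y) = 4 * (m : ℝ) ^ 6 * c ^ 2 * ν ^ 2 / (1 + ε₀) ^ 3 := by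
    simp only [hY, ha, hb, hP2eq, div_pow, mul_pow]
    rw [hP5sq]
    have hν0 : ν ≠ 0 := hν.ne'
    field_simp
    ring
  calc (1 + ε₀) ^ (n + 1) * ‖shellVec X ((n : ℤ) + 1) t₀‖ ^ 2 ≤ (1 + ε₀) ^ (n + 1) * (2 * Y) :=
        mul_le_mul_of_nonneg_left hfin (pow_nonneg hl0.le _)
    _ = 4 * (m : ℝ) ^ 6 * c ^ 2 * ν ^ 2 / (1 + ε₀) ^ 3 := hval

end Summit.NavierStokesRegularity.NavierStokesRegularity.Theorems.MinimalViscousBlowup.ThresholdRay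

end
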